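import Summits.QuantumFields.BalabanUV.Beta.SymMixedReflectionLetterAn1
import Summits.QuantumFields.BalabanUV.Beta.SymWardLettersAn1
import Summits.QuantumFields.BalabanUV.Beta.CombLamSectorLetters

/-!
# `BalabanUV.Beta.SymLamGroupScaling` — row D1 ∕ (C1), RULING R-D1-g56-4 (4-2) + SPEC (III″) v1.0 §4 ∕ A-1: **THE Λ GROUP OF THE D1 LITERAL IS
# DEGREE-1 HOMOGENEOUS** — the multiplier table, the mixed Ward data piece, the mixed Ward residuals, the mixed reflection letter (T2-mix) with its
# remainder, and the Λ-sector weight at the HOMOGENEOUS lock `cΛ·Lc⁴ = 2·κ` are `κ •` their landed forms at the typed pin; parity and letters pass through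

WHY ([AN2-G56-R4] l.62966 (4-2), [AN2-G56-SPEC10] l.63005 + A-1 l.63035; leaf-01 g41 A-2∕A-5, leaf-03 g49 N-1∕A-1, d1-p2 g29 F-g29-1∕R-g29-2, Engine C T-c):
by value the typed (III′) literal's Λ group (first-order Λ stencil `cΛ·SLam`, multiplier table `M1Of … cΛ`, mixed table `symMixFFAt`) is the genuine
multiplier-Hessian class C of B12 (2.12)'s Lagrangian Hessian at the common scale `4∕Lc¹²`, word by word (three programs, ≤ 1e−12); the (III″) literal
is therefore ROOT M‴'s objects with that group carried at weight `κ = Lc¹²∕4`: `cΛ ↦ κ·cΛ`, `symMixFFAt ↦ κ • symMixFFAt`, the typed RELATIVE lock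
`cΛ·Lc⁴ = 2` between them kept.  Every Λ-group LETTER the M‴ chain consumes speaks of Λ-group kernels ALONE and is linear in them, so its (III″)
twin is the landed letter scaled by `κ`.  This file records the scalings BY NAME over the tree's objects ([folklore] linear algebra; no Ward
mathematics re-done, an1's ∕ an3's letters consumed by name): §1 `M1Of … (κ·cΛ) = κ • M1Of … cΛ`; §2 the mixed Ward data piece and residuals
(`symDatM`, `symRWof`, `symRMAn1`, `RMof`): `κ •` the landed residual at `cΛ` IS the residual of (`κ •` Ward piece, pin `κ·cΛ`), and it stays
row-parity-odd at the lock (`parityOdd_smul`); §3 the mixed reflection letter (T2-mix) `SymMixedReflectionLetterAn1.hM2_symMixFFAt` for the table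
`κ • symMixFFAt` with multiplier pin `κ·cΛ` and remainder `κ • symRMrAn1 Lc cΛ γ` (every `cΛ`, `γ`, level); §4 the Λ-sector weight at the homogeneous
lock.  Companion files: `CombMixedT2SiteLetterScaled` ((T2-M₂) per site at the homogeneous lock), leaf-04's `SymTablesAn1S2Weighted` (the record
with the mixed slot at weight `w`, `weightLock_of_lock`).
WHAT THIS IS NOT: not the (III″) root; no pin VALUE asserted (`κ`, `cΛ` parameters; `κ = Lc¹²∕4` is the root's display, gated by value by
`R-AN2-56-ATK`); RECORD (ROOT M‴ p325680) unchanged; 0∕4 row-D1 binders; NOT D1, NEVER «G-an2-4 closed», NOT BetaPertH, NOT continuum, NOT Clay.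

HONEST DEPENDENCY (page 1, mandatory): continuum YM on T⁴ ⇐ BetaPertH ∧ nine spine estimates (0/9 proved); BetaPertH ⇐ (D1) ∧ (D4) ∧ CAP+tail;
G-an2-4 gates asym, D1 and NE2/3/4.  Row D1 ∕ (C1) OWNER an2, gen 56, 2026-08-25.  No existing file touched.
-/

noncomputable section

open Finset
open scoped BigOperators
open Literature.MathematicalPhysics.QuantumFieldTheory
open Literature.MathematicalPhysics.QuantumFieldTheory.Balaban1983to89
open Literature.MathematicalPhysics.QuantumFieldTheory.Balaban1983to89.Beta
open ExpKernelCalculus (MKer comp)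
open PolarizationSign (reflSign)
open KernelReflection (refK)
open ResolventReflection (bref Φ)
open AffineAveraging (box toSite)
open AveragingContoursRooted (ctr ctrOff)
open OneStepResolventKernel (Fib)
open BalabanStepJetsSucc (wVH wΛ)
open BalabanStepW2 (M2Of wM1 wM2)
open Summit.QuantumFields.BalabanUV.Beta.TameKernelCalculus (trK)
open Summit.QuantumFields.BalabanUV.Beta.ChartConjugation (conjV)
open Summit.QuantumFields.BalabanUV.Beta.BorderedHessian (bhK diagK ctGen sgnK comp_diagK_left comp_diagK_right)
open Summit.QuantumFields.BalabanUV.Beta.E3ContactGenerator (ctGenM)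
open Summit.QuantumFields.BalabanUV.Beta.DshAn1 (Dsh)
open Summit.QuantumFields.BalabanUV.Beta.AveragingWardRootedStencils (legInd)
open Summit.QuantumFields.BalabanUV.Beta.SpineRooted (M1Of M1Of_apply)
open Summit.QuantumFields.BalabanUV.Beta.WardLocusParityLevels (M2Of_apply)
open Summit.QuantumFields.BalabanUV.Beta.SpineRecursiveParity (parityOdd_smul)
open Summit.QuantumFields.BalabanUV.Beta.E3LevelOneReflection (refK_smul)
open Summit.QuantumFields.BalabanUV.Beta.SymAveragingHessianCounts (symHessFFAt)
open Summit.QuantumFields.BalabanUV.Beta.SymAveragingMixedJetTables (symMixFFAt)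
open Summit.QuantumFields.BalabanUV.Beta.SymMixedWardPacking (symWardM symDatM symRWof)
open Summit.QuantumFields.BalabanUV.Beta.SymWardLettersAn1 (symRMAn1 hRMp_sym_of_lock)
open Summit.QuantumFields.BalabanUV.Beta.SymMixedReflectionLetterAn1 (symRMrAn1 hM2_symMixFFAt)
open Summit.QuantumFields.BalabanUV.Beta.MixedLetterPacking (RMof parityOdd_RMof)
open Summit.QuantumFields.BalabanUV.Beta.CombLamSectorLetters (lamWeight_eq)

namespace Summit.QuantumFields.BalabanUV.Beta.SymLamGroupScaling

variable {Lc : ℕ} [NeZero Lc]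

/-! ## §1 The multiplier table is linear in its pin -/

omit [NeZero Lc] in
/-- [folklore] **`M1Of` IS LINEAR IN THE PIN**: `M1Of d Lc H (κ·cΛ) j = κ • M1Of d Lc H cΛ j` (generic `d`, any table `H`). -/
theorem M1Of_mul_pin {d : ℕ} (H : Fin (d + 1) → (Fin (d + 1) → ℤ) → MKer (d + 1) (Fib d)) (κ cΛ : ℝ) (j : ℕ) :
    M1Of d Lc H (κ * cΛ) j = κ • M1Of d Lc H cΛ j := by
  funext μ w
  rw [Pi.smul_apply, Pi.smul_apply, M1Of_apply, M1Of_apply, smul_smul, mul_assoc]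

omit [NeZero Lc] in
/-- [folklore] A diagonal contact of the re-pinned multiplier table scales: `conjV (M1Of … (κ·cΛ) j ρ w) (diagK g) = κ • conjV (M1Of … cΛ j ρ w) (diagK g)`. -/
theorem conjV_M1Of_mul_pin_diagK {d : ℕ} (H : Fin (d + 1) → (Fin (d + 1) → ℤ) → MKer (d + 1) (Fib d)) (κ cΛ : ℝ) (j : ℕ)
    (ρ : Fin (d + 1)) (w : Fin (d + 1) → ℤ) (g : (Fin (d + 1) → ℤ) → Fib d → ℝ) :
    conjV (M1Of d Lc H (κ * cΛ) j ρ w) (diagK g) = κ • conjV (M1Of d Lc H cΛ j ρ w) (diagK g) := by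
  funext x z a b
  simp only [ChartConjugation.conjV, Pi.sub_apply, Pi.smul_apply, smul_eq_mul, comp_diagK_left, comp_diagK_right, M1Of_apply]
  ring

/-! ## §2 The mixed Ward data piece and residuals -/

/-- [folklore] **THE MIXED WARD DATA PIECE IS LINEAR IN THE PIN**: `symDatM Lc (κ·cΛ) = κ • symDatM Lc cΛ` (pointwise). -/
theorem symDatM_mul_pin (κ cΛ : ℝ) (y : Fin (3 + 1) → ℤ) (ρ' : Fin (3 + 1)) (w : Fin (3 + 1) → ℤ) :
    symDatM Lc (κ * cΛ) y ρ' w = κ • symDatM Lc cΛ y ρ' w := by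
  funext x z a b
  simp only [SymMixedWardPacking.symDatM, Pi.sub_apply, Pi.smul_apply, smul_eq_mul, comp_diagK_left, comp_diagK_right, M1Of_apply]
  ring

/-- [folklore] **THE SCALED RESIDUAL IS THE RESIDUAL OF THE SCALED GROUP**: `κ • symRWof Lc cΛ y ρ′ w = κ • symWardM Lc y ρ′ w − symDatM Lc (κ·cΛ) y ρ′ w`
— the mixed Ward piece at weight `κ` minus the data piece at pin `κ·cΛ`. -/
theorem smul_symRWof_eq (κ cΛ : ℝ) (y : Fin (3 + 1) → ℤ) (ρ' : Fin (3 + 1)) (w : Fin (3 + 1) → ℤ) :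
    κ • symRWof Lc cΛ y ρ' w = κ • symWardM Lc y ρ' w - symDatM Lc (κ * cΛ) y ρ' w := by
  rw [symDatM_mul_pin, ← smul_sub]
  rfl

/-- [folklore] **THE SCALED LEVEL RESIDUAL**: `κ • symRMAn1 Lc cΛ j y ρ′ w = wM1 j • (κ • symWardM Lc y ρ′ w − symDatM Lc (κ·cΛ) y ρ′ w)`. -/
theorem smul_symRMAn1_eq (κ cΛ : ℝ) (j : ℕ) (y : Fin 4 → ℤ) (ρ' : Fin 4) (w : Fin 4 → ℤ) :
    κ • symRMAn1 Lc cΛ j y ρ' w = wM1 3 Lc j • (κ • symWardM Lc y ρ' w - symDatM Lc (κ * cΛ) y ρ' w) := by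
  rw [← smul_symRWof_eq, smul_comm]
  rfl

/-- [folklore] **(WM-p) FOR THE SCALED GROUP AT THE LOCK** — the binder `hRMp` with `RM := κ • symRMAn1 Lc cΛ` is unconditional at `cΛ·Lc⁴ = 2`
(`SymWardLettersAn1.hRMp_sym_of_lock` + `parityOdd_smul`): every `κ`, every level. -/
theorem hRMp_sym_of_lock_smul {cΛ : ℝ} (hΛ : cΛ * (Lc : ℝ) ^ 4 = 2) (κ : ℝ) :
    ∀ (j : ℕ) (y : Fin 4 → ℤ) (ρ' : Fin 4) (w : Fin 4 → ℤ),
      trK (κ • symRMAn1 Lc cΛ j y ρ' w) = -sgnK (κ • symRMAn1 Lc cΛ j y ρ' w) :=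
  fun j y ρ' w => parityOdd_smul κ (hRMp_sym_of_lock hΛ j y ρ' w)

/-- [folklore] **THE hR END's MIXED RESIDUAL, SCALED, IS ROW-PARITY-ODD AT THE LOCK** (`MixedLetterPacking.parityOdd_RMof` + `parityOdd_smul`). -/
theorem parityOdd_smul_RMof {cΛ : ℝ} (hΛ : cΛ * (Lc : ℝ) ^ 4 = 2) (κ : ℝ) (α κ' : Fin 4) (u : Fin 4 → ℤ) (ρ' : Fin 4) (w : Fin 4 → ℤ) :
    trK (κ • RMof Lc cΛ α κ' u ρ' w) = -sgnK (κ • RMof Lc cΛ α κ' u ρ' w) :=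
  parityOdd_smul κ (parityOdd_RMof hΛ α κ' u ρ' w)

/-! ## §3 The mixed reflection letter (T2-mix) for the scaled group -/

omit [NeZero Lc] in
/-- [folklore] The mixed data slot is linear in the table: `M2Of 3 Lc (κ • mixFF) j κ′ u ρ w = κ • M2Of 3 Lc mixFF j κ′ u ρ w`. -/
theorem M2Of_smul_table (κ : ℝ) (mixFF : Fin 4 → (Fin 4 → ℤ) → Fin 4 → (Fin 4 → ℤ) → MKer 4 (Fib 3)) (j : ℕ)
    (κ' : Fin 4) (u : Fin 4 → ℤ) (ρ : Fin 4) (w : Fin 4 → ℤ) :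
    M2Of 3 Lc (κ • mixFF) j κ' u ρ w = κ • M2Of 3 Lc mixFF j κ' u ρ w := by
  simp only [M2Of_apply, Pi.smul_apply, smul_smul, mul_comm]

omit [NeZero Lc] in
/-- [folklore] **(T2-mix) FOR THE SCALED Λ GROUP** — `SymMixedReflectionLetterAn1.hM2_symMixFFAt` with the mixed table `κ • symMixFFAt ρ_c Lc`, the
multiplier pin `κ·cΛ` and the remainder `κ • symRMrAn1 Lc cΛ γ`: every `κ`, `cΛ`, `γ`, level, axis (the landed letter scaled; `refK` and the
diagonal contact are linear).  At `κ = 1` it is the landed letter; the (III″) root displays `κ = Lc¹²∕4`. -/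
theorem hM2_smul_symMixFFAt (hLc : Odd Lc) (κ cΛ : ℝ) (γ : ℕ → ℝ) :
    ∀ (j : ℕ) (α κ' : Fin 4) (u : Fin 4 → ℤ) (ρ : Fin 4) (w : Fin 4 → ℤ),
      M2Of 3 Lc (κ • symMixFFAt (ctr 4 Lc) Lc) j κ' (bref α κ' u) ρ (bref α ρ w) =
        (reflSign α κ' * reflSign α ρ) • refK (Φ Lc α)
          (M2Of 3 Lc (κ • symMixFFAt (ctr 4 Lc) Lc) j κ' u ρ w
            + conjV (M1Of 3 Lc (symHessFFAt (ctr 4 Lc) Lc) (κ * cΛ) j ρ w) (diagK fun p c => γ j * ctGenM 3 (bhK Lc + Dsh Lc) α Lc κ' u p c)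
            + κ • symRMrAn1 Lc cΛ γ j α κ' u ρ w) := by
  intro j α κ' u ρ w
  have h := hM2_symMixFFAt hLc cΛ γ j α κ' u ρ w
  rw [M2Of_smul_table, M2Of_smul_table, conjV_M1Of_mul_pin_diagK, ← smul_add, ← smul_add, refK_smul, h, smul_comm]

/-! ## §4 The Λ-sector weight at the homogeneous lock -/

/-- [folklore] **AT THE HOMOGENEOUS LOCK `cΛ·Lc⁴ = 2·κ`** the Λ-sector weight is `κ·(−4∕Lc¹²)`: `cΛ·wΛ_j = (−4κ∕Lc¹²·wVH_j)·(−Lc⁸∕2·wVH_j)` —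
`CombLamSectorLetters.lamWeight_eq_of_lock` is the instance `κ = 1`. -/
theorem lamWeight_eq_of_lock_smul {cΛ κ : ℝ} (hΛ : cΛ * (Lc : ℝ) ^ 4 = 2 * κ) (j : ℕ) :
    cΛ * wΛ 3 Lc j = (-(4 * κ) / (Lc : ℝ) ^ 12 * wVH 3 Lc j) * (-((Lc : ℝ) ^ 8 / 2) * wVH 3 Lc j) := by
  have hL : (Lc : ℝ) ≠ 0 := Nat.cast_ne_zero.2 (NeZero.ne Lc)
  have hc : cΛ = 2 * κ / (Lc : ℝ) ^ 4 := by
    rw [eq_div_iff (pow_ne_zero _ hL)]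
    exact hΛ
  rw [lamWeight_eq, hc]
  field_simp
  ring

end Summit.QuantumFields.BalabanUV.Beta.SymLamGroupScaling

end
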